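import Summits.BirchSwinnertonDyer.BirchSwinnertonDyer.Theorems.KatoDescentPotSupersingularKatoSelmerPTCokernelSharp
import Summits.BirchSwinnertonDyer.BirchSwinnertonDyer.Theorems.KatoDescentPotSupersingularUnramifiedLevelRaise
import Summits.BirchSwinnertonDyer.BirchSwinnertonDyer.Theorems.KatoDescentPotSupersingularH1TateTorsionKummer
import Summits.BirchSwinnertonDyer.BirchSwinnertonDyer.Theorems.KatoDescentPotSupersingularKatoReciprocityIsotropy
import HarnessLib

/-!
# Reductions of integral `T`-adic classes are ORTHOGONAL to the test tuples of the Poitou–Tate cokernel count: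
# `⟨g_ℓ, (desc^♭)_* loc_ℓ red_{p^k} c⟩_ℓ = 0` for `c ∈ H¹(ℤ[1/p], T_pE)`, `g_ℓ ∈ ι_k⁻¹ H¹_ur(ℚ_ℓ, E[p^∞])`, `ℓ ≠ p`; hence the sharp companion (ii)
# `#Sel_{p^∞} · ∏ #H¹_ur · #(A ⊓ H¹(ℚ,T_pE)[p^N]) ≤ #S · [E(ℚ) : p^k E(ℚ)]`
# (route `KatoDescentPotSupersingular` / `…Tame…`, crux M = stmt-BirchSwinnertonDyer-19196, U₀-red 19190/19203; route-free helper)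

Seat `bsd-potss-rkm` g24 (prover; cell `bsd-potss`), TARGET R283 / wake W-M6 (`--supports …`; closes nothing).  HONEST FRAMING: BSD is not
proved by any of this; nothing is booked; theorems only (no definition, no named fact).  CONDITIONAL on the finite-level Poitou–Tate
predicates (`IsPerfect`, `SelmerComplement`) of a family of local invariant maps, as in every PT count of the cell.

## What

* `localTatePairingZMod_map_descend_reduceH1Pk_eq_zero` — `ℓ ≠ p` a finite place, (hN) at `ℓ` for `(k, s)` (g17 `exists_forall_hN`), `c ∈ A =
  H¹(ℤ[1/p], T_pE)` (`integralH1`), `g_ℓ ∈ H¹(ℚ_ℓ, E[p^k])` with `(ι_k)_* g_ℓ` unramified: **`⟨g_ℓ, (desc^♭)_* loc_ℓ (ι′_* red_{p^k} c)⟩_ℓ = 0`**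
  (`desc` the descended Weil pairing of a level-`p^s p^k` datum `e`, any additive `inv_ℓ`).  PROOF: `ι′_* red_{p^k} c = [p^s]_* c′`,
  `c′ = ι″_* red_{p^{k+s}} c` (tower, `map_mulK_map_torsionInclusion_reduceH1Pk_add`); adjointness
  `⟨g, (desc^♭)_* loc [p^s]_* c′⟩ = ⟨incl_* g, loc (w′_* c′)⟩` (part 44a); `incl_* g` is UNRAMIFIED at level `p^s p^k` (`…UnramifiedLevelRaise`)
  and so is `loc (w′_* c′)` (`c′` integral: part 31 + naturality); unramified classes are orthogonal (Milne I 2.6 with no hypothesis on the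
  inertia action, `UnramifiedSelfDual`).
* **`natCard_selmerGroupPInfty_mul_prod_unramified_mul_torsion_le_index`** — the sharp companion (ii) for Kato's `A`:
  `#Sel_{p^∞}(E/ℚ) · ∏_{ℓ∈T∖p} #H¹_ur(ℚ_ℓ,E[p^∞]) · #(A ⊓ H¹(ℚ,T_pE)[p^N]) ≤ #S · [E(ℚ) : p^k E(ℚ)]` — part 44b's hypotheses plus (hN) at every
  `ℓ ∈ T∖p` for `(k, s)`, `W(ℚ)` finite and `#W(ℚ)_tors < p^k`: the subgroup `H = ι′_* red_{p^k}(A ⊓ H¹(ℚ,T_pE)[p^N])` lies in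
  `Sel^{(p^k)} ⊓ ker(E[p^k] ↪ E)_*` with `#H ≥ #(A ⊓ H¹(ℚ,T_pE)[p^N])` (`…H1TateTorsionKummer`) and is orthogonal to the test tuples (above), so
  `…PTCokernelSharp` applies.  In rank `0`, `N ≫ 0`: `#(A ⊓ H¹(ℚ,T_pE)[p^N]) = #A_tors = #H¹_f(ℤ[1/p],T)` — Kato's p. 244.

References: K. Kato, Astérisque 295 (2004), §14.8 (p. 238), proof of Prop. 14.16 (pp. 244–245) [Kato2004Asterisque]; R. Greenberg, LNM 1716
(1999), §3 Lemma 3.3, appendix to §4 [GreenbergLNM1716]; J. S. Milne, *ADT* I Cor. 2.3, Thm. 2.6, Thm. 4.10 (b) [MilneADT2006].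
-/

-- the summit and its single problem are both named `BirchSwinnertonDyer` (registry layout D-0017)
set_option linter.dupNamespace false
set_option autoImplicit false

noncomputable section

open scoped Classical ContRepresentation NumberField AddSubgroup
open CategoryTheory Function Field NumberField IsDedekindDomain WeierstrassCurve
open Literature.NumberTheory.EllipticCurves Literature.NumberTheory.GaloisRepresentations
  Literature.NumberTheory.GaloisRepresentations.DiscreteGaloisModule Literature.NumberTheory.GaloisCohomology
open Literature.NumberTheory.EllipticCurves.Kato2004 Literature.NumberTheory.EllipticCurves.Kato2004.EulerSystemValues
open Summit.BirchSwinnertonDyer.Rank1Residual.X11b.Levels Summit.BirchSwinnertonDyer.Rank1Residual.X11b.LocBridge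
  Summit.BirchSwinnertonDyer.Rank1Residual.X11b.LevelKummer
open Summit.BirchSwinnertonDyer.Rank1Residual.GaloisImage
open Summit.BirchSwinnertonDyer.BirchSwinnertonDyer.Theorems.KummerTowerOrthogonal
open Summit.BirchSwinnertonDyer.BirchSwinnertonDyer.Rank1Residual (StepFour.localization_map_mem_unramifiedSubgroup)

namespace Summit.BirchSwinnertonDyer.BirchSwinnertonDyer.Theorems.KatoFiniteLevelCount

section Orthogonal

variable (W : WeierstrassCurve ℚ) [W.IsElliptic] (p s k : ℕ) [Fact p.Prime] [ContinuousSMul ℤ_[p] (W.tateModule p)]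
  (T : Finset (HeightOneSpectrum (𝓞 ℚ)))
  (e : geomTorsion W ((p ^ s * p ^ k : ℕ) : ℤ) → geomTorsion W ((p ^ s * p ^ k : ℕ) : ℤ) → AlgebraicClosure ℚ)
  (hμ : ∀ S T, e S T ^ (p ^ s * p ^ k) = 1)
  (hadd₁ : ∀ S₁ S₂ T, e (S₁ + S₂) T = e S₁ T * e S₂ T)
  (hadd₂ : ∀ S T₁ T₂, e S (T₁ + T₂) = e S T₁ * e S T₂)
  (hgal : ∀ (σ : absoluteGaloisGroup ℚ) (S T : geomTorsion W ((p ^ s * p ^ k : ℕ) : ℤ)), σ • e S T = e (σ • S) (σ • T))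
  (inv : LocalInvariants ℚ (p ^ s * p ^ k))
  [Finite (geomTorsion W ((p ^ s * p ^ k : ℕ) : ℤ))] [Finite (geomTorsion W ((p ^ k : ℕ) : ℤ))]

/-- **`⟨g_ℓ, (desc^♭)_* loc_ℓ (ι′_* red_{p^k} c)⟩_ℓ = 0`** for `c ∈ H¹(ℤ[1/p], T_pE)`, `ℓ ≠ p`, `g_ℓ ∈ H¹(ℚ_ℓ, E[p^k])` with `(ι_k)_* g_ℓ` unramified,
granted (hN) at `ℓ` for `(k, s)`: tower + adjointness move the pairing to level `p^s p^k`, where both classes are unramified, hence orthogonal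
(Milne I 2.6, no hypothesis on the inertia action). [cite: MilneADT2006, Ch. I, Cor. 2.3 and Thm. 2.6] [cite: Kato2004Asterisque, proof of Prop. 14.16 (pp. 244–245)] -/
theorem localTatePairingZMod_map_descend_reduceH1Pk_eq_zero (ℓ : HeightOneSpectrum (𝓞 ℚ)) (hℓ : ℓ ≠ primePlace p)
    (hN : ∀ x : W.geomPrimaryTorsion p,
      (∀ τ ∈ absInertia (ℓ.adicCompletion ℚ), GaloisRep.toLocal ℓ (primaryGaloisModule W p) τ x = x) →
        ∃ d : W.geomPrimaryTorsion p,
          (∀ τ ∈ absInertia (ℓ.adicCompletion ℚ), GaloisRep.toLocal ℓ (primaryGaloisModule W p) τ d = d) ∧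
            p ^ (k + s) • d = p ^ s • x)
    {c : H1 (tateRep W p) ⊤} (hc : c ∈ integralH1 (tateRep W p) p ⊤)
    {gℓ : galoisCohomology ((W.torsionGaloisModule ((p ^ k : ℕ) : ℤ)).toLocal (Sum.inr ℓ)) 1}
    (hgℓ : galoisCohomology.map ((primaryInclusion W p k).restrictField (ℓ.adicCompletion ℚ)) 1 gℓ ∈
      unramifiedSubgroup (GaloisRep.toLocal ℓ (primaryGaloisModule W p)) 1) :
    localTatePairingZMod (W.torsionGaloisModule ((p ^ k : ℕ) : ℤ)) (p ^ s * p ^ k) (Sum.inr ℓ) (inv (Sum.inr ℓ)) gℓ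
        (galoisCohomology.map ((DiscreteGaloisModule.pairingDualIntertwining
            (ρ₁ := W.torsionGaloisModule ((p ^ k : ℕ) : ℤ)) (ρ₂ := W.torsionGaloisModule ((p ^ k : ℕ) : ℤ))
            (B := descendHom W (p ^ s) (p ^ k) e hμ hadd₁ hadd₂)
            (descendHom_smul W (p ^ s) (p ^ k) e hμ hadd₁ hadd₂ hgal)).restrictField (ℓ.adicCompletion ℚ)) 1
          (galoisCohomology.localization (W.torsionGaloisModule ((p ^ k : ℕ) : ℤ)) (Sum.inr ℓ) 1
            (galoisCohomology.map (W.torsionInclusion (intPow_dvd_natCast_pow p k)) 1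
              ((ofTopSubgroup (W.torsionGaloisModule ((p : ℤ) ^ k)).toTopRep 1).hom (reduceH1Pk W p k ⊤ c))))) = 0 := by
  haveI := neZero_pow p s; haveI := neZero_pow p k
  -- the tower: `ι′_* red_{p^k} c = [p^s]_* c′`, `c′ = ι″_* red_{p^{k+s}} c`; adjointness to level `p^s p^k`
  rw [← map_mulK_map_torsionInclusion_reduceH1Pk_add W p k s c,
    ← localTatePairingZMod_map_inclKD_localization_weilDual W p s k e hμ hadd₁ hadd₂ hgal inv ℓ gℓ]
  -- both classes are unramified at level `p^s p^k`
  refine UnramifiedSelfDual.localTatePairingZMod_eq_zero_of_mem_unramifiedSubgroup _ (p ^ s * p ^ k) ℓ (inv (Sum.inr ℓ))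
    (map_inclKD_mem_unramifiedSubgroup_of_map_primaryInclusion_mem W p s k ℓ hN hgℓ) ?_
  exact StepFour.localization_map_mem_unramifiedSubgroup _ ℓ
    (StepFour.localization_map_mem_unramifiedSubgroup _ ℓ
      (localization_ofTopSubgroup_reduceH1Pk_mem_unramifiedSubgroup W p (k + s) hc hℓ))

include hμ hadd₁ hadd₂ hgal in
/-- **THE SHARP COMPANION (ii) FOR KATO'S `A = H¹(ℤ[1/p], T_pE)`:
`#Sel_{p^∞}(E/ℚ) · ∏_{ℓ ∈ T∖{p}} #H¹_ur(ℚ_ℓ, E[p^∞]) · #(A ⊓ H¹(ℚ,T_pE)[p^N]) ≤ #S · [E(ℚ) : p^k E(ℚ)]`** — part 44b's hypotheses, plus (hN) at every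
`ℓ ∈ T∖p` for `(k, s)`, `W(ℚ)` finite and `#W(ℚ)_tors < p^k`.  The missing factor `#H¹_f(ℤ[1/p],T) = #A_tors` of Kato's / Greenberg–Cassels' count
(p. 244) enters through `H = ι′_* red_{p^k}(A ⊓ H¹(ℚ,T_pE)[p^N])` (`…H1TateTorsionKummer`, `…PTCokernelSharp`, and the orthogonality above).
[cite: Kato2004Asterisque, §14.8 (p. 238) and proof of Prop. 14.16 (pp. 244–245)] [cite: GreenbergLNM1716, appendix to §4]
[cite: MilneADT2006, Ch. I, Thm. 2.6 and Thm. 4.10 (b)] -/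
theorem natCard_selmerGroupPInfty_mul_prod_unramified_mul_torsion_le_index
    (hodd : p ≠ 2) (hk1 : 1 ≤ k)
    (halt : ∀ P, e P P = 1) (hnondeg : ∀ P, (∀ Q, e Q P = 1) → P = 0) (hperf : inv.IsPerfect)
    (hcompl : inv.SelmerComplement)
    (hpT : primePlace p ∈ T) (hT : ∀ v : HeightOneSpectrum (𝓞 ℚ), v ∉ T → W.HasGoodReductionAt v)
    [Finite (W.selmerGroupPInfty p)] [Finite W.toAffine.Point] (hk : W.torsionOrder < p ^ k)
    (𝓤inf : SelmerStructure (primaryGaloisModule W p))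
    (hUp : 𝓤inf (Sum.inr (primePlace p)) = ⊤)
    (hUur : ∀ v : HeightOneSpectrum (𝓞 ℚ), v ≠ primePlace p →
      𝓤inf (Sum.inr v) = unramifiedSubgroup (GaloisRep.toLocal v (primaryGaloisModule W p)) 1)
    (hUinl : ∀ w : InfinitePlace ℚ, 𝓤inf (Sum.inl w) = ⊤)
    (𝓖' : SelmerStructure (W.torsionGaloisModule ((p ^ s * p ^ k : ℕ) : ℤ)))
    (hle : W.kummerSelmerStructure ((p ^ s * p ^ k : ℕ) : ℤ) ≤ 𝓖')
    (h𝓖good : ∀ v : HeightOneSpectrum (𝓞 ℚ), v ∉ T →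
      𝓖' (Sum.inr v) = unramifiedSubgroup (GaloisRep.toLocal v (W.torsionGaloisModule ((p ^ s * p ^ k : ℕ) : ℤ))) 1)
    (h𝓖T : ∀ v ∈ T, v ≠ primePlace p →
      𝓖' (Sum.inr v) = (unramifiedSubgroup (GaloisRep.toLocal v (primaryGaloisModule W p)) 1).comap
        (galoisCohomology.map (((primaryInclusion W p (s + k)).comp
          (W.torsionInclusion (natCast_pow_mul_pow_dvd_natCast_pow_add p s k))).restrictField (v.adicCompletion ℚ)) 1))
    (h𝓖p : 𝓖' (Sum.inr (primePlace p)) = W.kummerSelmerStructure ((p ^ s * p ^ k : ℕ) : ℤ) (Sum.inr (primePlace p)))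
    (hs : ∀ a ∈ W.sha, ((p ^ s * p ^ k : ℕ) : ℤ) • a = 0 → p ^ s • a = 0)
    (hK : ∀ v ∈ T \ {primePlace p},
      ∀ u ∈ unramifiedSubgroup (GaloisRep.toLocal v (primaryGaloisModule W p)) 1, p ^ k • u = 0)
    (hN : ∀ v ∈ T \ {primePlace p}, ∀ x : W.geomPrimaryTorsion p,
      (∀ τ ∈ absInertia (v.adicCompletion ℚ), GaloisRep.toLocal v (primaryGaloisModule W p) τ x = x) →
        ∃ d : W.geomPrimaryTorsion p,
          (∀ τ ∈ absInertia (v.adicCompletion ℚ), GaloisRep.toLocal v (primaryGaloisModule W p) τ d = d) ∧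
            p ^ (k + s) • d = p ^ s • x)
    (N : ℕ) :
    Nat.card (W.selmerGroupPInfty p) *
        (∏ v ∈ T \ {primePlace p}, Nat.card (unramifiedSubgroup (GaloisRep.toLocal v (primaryGaloisModule W p)) 1)) *
        Nat.card ↥((integralH1 (tateRep W p) p ⊤).toAddSubgroup ⊓ (H1 (tateRep W p) ⊤)[((p ^ N : ℕ) : ℤ)]) ≤
      Nat.card ↥(𝓤inf.selmerGroup ⊓ selmerLocalKerPrimary W ((primePlace p).adicCompletion ℚ) p) *
        (zsmulAddGroupHom ((p ^ k : ℕ) : ℤ) : W.toAffine.Point →+ W.toAffine.Point).range.index := by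
  -- the subgroup `H = ι′_* red_{p^k}(A ⊓ H¹(ℚ,T_pE)[p^N])`
  obtain ⟨hcard, hHle⟩ := H1TateTorsion.natCard_inf_torsionBy_le_natCard_map_inf W k hk
    (integralH1 (tateRep W p) p ⊤).toAddSubgroup N
  have h := natCard_selmerGroupPInfty_mul_prod_unramified_mul_le_index W p s k T e hμ hadd₁ hadd₂ hgal inv hodd hk1 halt hnondeg
    hperf hcompl hpT hT 𝓤inf hUp hUur hUinl 𝓖' hle h𝓖good h𝓖T h𝓖p hs hK _ hHle ?_
  · exact (Nat.mul_le_mul_left _ hcard).trans h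
  · -- orthogonality: the classes of `H` are reductions of integral classes
    rintro ℓ gℓ hgℓ _ ⟨c, hc, rfl⟩
    have hℓ : ℓ.1 ∈ T ∧ ℓ.1 ≠ primePlace p := by
      have h' := Finset.mem_sdiff.1 ℓ.2
      exact ⟨h'.1, fun h'' => h'.2 (Finset.mem_singleton.2 h'')⟩
    rw [AddMonoidHom.comp_apply, AddMonoidHom.comp_apply]
    exact localTatePairingZMod_map_descend_reduceH1Pk_eq_zero W p s k e hμ hadd₁ hadd₂ hgal inv ℓ.1 hℓ.2 (hN ℓ.1 ℓ.2) hc.1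
      (AddSubgroup.mem_comap.mp hgℓ)

end Orthogonal

end Summit.BirchSwinnertonDyer.BirchSwinnertonDyer.Theorems.KatoFiniteLevelCount

end
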